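import Summits.AtomisticToContinuum.HydrodynamicLimit.Theorems.InformationPercolationEngineChaosClosesEulerEntropyBalanceD
import HarnessLib

/-!
# Windowed entropy balance — helper E: the exact jump of the windowed functional

Helper file for the registered stub `stub_windowedEntropyBalance` of the line `empirical-h-theorem`
(crux `InformationPercolationEngine.ChaosClosesEuler`, stmt-AtomisticToContinuum-15141).

WHAT. Integration of the velocity-level jump identity of helper D over the window: for two
configurations with the same positions whose velocities differ only on a pair `{p, q}` of
conserved kinetic energy, the sum over all particles of the windowed entropic marks
`Σₖ ∫ₓ b_r(x, x₀) h(ρ_r(x)) b_r(xₖ, x) (Λ̃_x(v'ₖ) − Λ̃_x(vₖ)) dx` equals `(N+1)(𝒮(w') − 𝒮(w))` up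
to `(3/(πr³)) C_h C_R⁰ (1 + |v_p|⁴ + |v_q|⁴)/(N+1)` (`abs_FS_jump_le`). The analytic input is the
measurability in the field point of the parametric velocity integrals `S(x)` and `Λ̃_x(a)`
(`measurable_SC`, `measurable_LamC`: strongly measurable integrands on `𝕋³ × ℝ³`), which makes the
bounded integrands integrable on the unit-volume torus, so that the finite particle sum and the
`x`-integral commute; the remainder is then bounded pointwise by helper D.

References: L. Boltzmann (1872); folklore.
-/

noncomputable section

namespace Summit.AtomisticToContinuum.HydrodynamicLimit.Theorems.ChaosClosesEulerEntropyBalance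

open scoped BigOperators Topology Classical MeasureTheory ENNReal InnerProductSpace
open Filter Set MeasureTheory ProbabilityTheory
open Literature.MathematicalPhysics.KineticTheory
open Literature.Analysis.FluidPDE
open Summit.AtomisticToContinuum.HydrodynamicLimit.Theorems.LocalSecondLawNegative (cone rhoC cone_nonneg
  continuous_cone rhoC_nonneg continuous_rhoC)
open Summit.AtomisticToContinuum.HydrodynamicLimit.Theorems.ChaosClosesEulerWindowedInvariance (cone_nonneg_le)
open Summit.AtomisticToContinuum.HydrodynamicLimit.Theorems.LocalSecondLawLedger.L (rhoC_eq_sum)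

variable {N : ℕ}

/-! ## §1 Measurability in the field point -/

/-- `x ↦ S(x)` is measurable (parametric integral of a jointly measurable integrand). [folklore] -/
theorem measurable_SC (r δ K : ℝ) (w : Config (N + 1) (Fin 3) T3) : Measurable fun x => SC r δ K w x := by
  have hf : Measurable fun p : T3 × V3 => sK (yfl K p.2) (gC r δ w p.1 p.2) :=
    measurable_sK₂.comp (((continuous_yfl K).measurable.comp measurable_snd).prodMk
      (continuous_gC₂ r δ w).measurable)
  exact (hf.stronglyMeasurable.integral_prod_right' (ν := (volume : Measure V3))).measurable

/-- `x ↦ Λ̃_x(a)` is measurable. [folklore] -/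
theorem measurable_LamC (r δ K : ℝ) (w : Config (N + 1) (Fin 3) T3) (a : V3) :
    Measurable fun x => LamC r δ K w x a := by
  have hf : Measurable fun p : T3 × V3 => phi δ (a - p.2) * flog (yfl K p.2) (gC r δ w p.1 p.2) :=
    ((continuous_phi δ).measurable.comp (measurable_const.sub measurable_snd)).mul
      (measurable_flog₂.comp (((continuous_yfl K).measurable.comp measurable_snd).prodMk
        (continuous_gC₂ r δ w).measurable))
  exact (hf.stronglyMeasurable.integral_prod_right' (ν := (volume : Measure V3))).measurable

/-- `x ↦ b_r(x, x₀)` is continuous. [folklore] -/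
theorem continuous_cone_left (r : ℝ) (x₀ : T3) : Continuous fun x => cone r x x₀ := by
  have h1 : Continuous fun x : T3 => Torus.euclidDist x x₀ := by
    simp_rw [Torus.euclidDist_eq]
    exact Torus.continuous_norm_reprSym.comp (continuous_id.sub continuous_const)
  unfold cone
  exact continuous_const.mul ((continuous_const.sub (h1.div_const _)).max continuous_const)

/-- A Lipschitz density weight is continuous. [folklore] -/
theorem continuous_of_lip {h : ℝ → ℝ} {Lh : ℝ} (hhL : ∀ a b, |h a - h b| ≤ Lh * |a - b|) : Continuous h := by
  have hL : 0 ≤ max Lh 0 := le_max_right _ _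
  refine (LipschitzWith.of_dist_le_mul (K := Real.toNNReal (max Lh 0)) fun a b => ?_).continuous
  rw [Real.dist_eq, Real.dist_eq, Real.coe_toNNReal _ hL]
  exact (hhL a b).trans (mul_le_mul_of_nonneg_right (le_max_left _ _) (abs_nonneg _))

/-- The integrand of `𝒮` is integrable on the torus. [folklore] -/
theorem integrable_FS_integrand {r δ : ℝ} (hr : 0 < r) (hδ : 0 < δ) (K : ℝ) {h : ℝ → ℝ} {Ch : ℝ}
    (hhb : ∀ a, |h a| ≤ Ch) (hcont : Continuous h) (x₀ : T3) (w : Config (N + 1) (Fin 3) T3) :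
    Integrable fun x => cone r x x₀ * h (rhoC r w x) * SC r δ K w x := by
  refine Integrable.of_bound ?_ (3 / (Real.pi * r ^ 3) * Ch * (CS r δ K * (1 + configEnergy w / (N + 1 : ℝ))))
    (Eventually.of_forall fun x => ?_)
  · exact (((continuous_cone_left r x₀).measurable.mul (hcont.measurable.comp (continuous_rhoC r w).measurable)).mul
      (measurable_SC r δ K w)).aestronglyMeasurable
  · rw [Real.norm_eq_abs, abs_mul, abs_mul, abs_of_nonneg (cone_nonneg hr _ _)]
    have hCh : 0 ≤ Ch := (abs_nonneg _).trans (hhb 0)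
    exact mul_le_mul (mul_le_mul (cone_nonneg_le hr _ _).2 (hhb _) (abs_nonneg _) (by positivity))
      (abs_SC_le hr hδ K w x) (abs_nonneg _) (by positivity)

/-- The integrand of one windowed mark is integrable on the torus. [folklore] -/
theorem integrable_mark_integrand {r δ : ℝ} (hr : 0 < r) (hδ : 0 < δ) (K : ℝ) {h : ℝ → ℝ} {Ch : ℝ}
    (hhb : ∀ a, |h a| ≤ Ch) (hcont : Continuous h) (x₀ : T3) (w : Config (N + 1) (Fin 3) T3) (k : Fin (N + 1))
    (a : V3) : Integrable fun x => cone r x x₀ * h (rhoC r w x) * cone r (w k).1 x * LamC r δ K w x a := by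
  refine Integrable.of_bound ?_ (3 / (Real.pi * r ^ 3) * Ch * (3 / (Real.pi * r ^ 3)) *
    ((|K| + |Real.log (Mg r δ)| + 6) * (c4 δ * (1 + ‖a‖ ^ 4)))) (Eventually.of_forall fun x => ?_)
  · exact ((((continuous_cone_left r x₀).measurable.mul (hcont.measurable.comp (continuous_rhoC r w).measurable)).mul
      (continuous_cone r (w k).1).measurable).mul (measurable_LamC r δ K w a)).aestronglyMeasurable
  · rw [Real.norm_eq_abs, abs_mul, abs_mul, abs_mul, abs_of_nonneg (cone_nonneg hr _ _),
      abs_of_nonneg (cone_nonneg hr _ _)]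
    have hCh : 0 ≤ Ch := (abs_nonneg _).trans (hhb 0)
    refine mul_le_mul ?_ (abs_LamC_le hr hδ K w x a) (abs_nonneg _) (by positivity)
    exact mul_le_mul (mul_le_mul (cone_nonneg_le hr _ _).2 (hhb _) (abs_nonneg _) (by positivity))
      (cone_nonneg_le hr _ _).2 (cone_nonneg hr _ _) (by positivity)

/-! ## §2 The exact jump of the windowed functional -/

/-- Same positions give the same mollified density. [folklore] -/
theorem rhoC_eq_of_pos (r : ℝ) {w w' : Config (N + 1) (Fin 3) T3} (hpos : ∀ k, (w' k).1 = (w k).1) (x : T3) :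
    rhoC r w' x = rhoC r w x := by
  rw [rhoC_eq_sum, rhoC_eq_sum]
  exact congrArg _ (Finset.sum_congr rfl fun k _ => by rw [hpos k])

/-- **Exact jump of the windowed coarse-grained entropy functional.** For configurations `w`, `w'`
with the same positions and velocities differing only on the pair `{p, q}`, of conserved kinetic
energy, the particle sum of the windowed entropic marks is `(N+1)(𝒮(w') − 𝒮(w))` up to
`(3/(πr³)) C_h C_R⁰ (1 + |v_p|⁴ + |v_q|⁴)/(N+1)`. [folklore] -/
theorem abs_FS_jump_le {r δ : ℝ} (hr : 0 < r) (hδ : 0 < δ) (K : ℝ) {h : ℝ → ℝ} {Ch : ℝ}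
    (hhb : ∀ a, |h a| ≤ Ch) (hcont : Continuous h) (x₀ : T3) {w w' : Config (N + 1) (Fin 3) T3}
    {p q : Fin (N + 1)} (hpq : p ≠ q) (hpos : ∀ k, (w' k).1 = (w k).1)
    (hvel : ∀ k, k ≠ p → k ≠ q → (w' k).2 = (w k).2)
    (hen : ‖(w' p).2‖ ^ 2 + ‖(w' q).2‖ ^ 2 = ‖(w p).2‖ ^ 2 + ‖(w q).2‖ ^ 2) :
    |(∑ k, ∫ x, cone r x x₀ * h (rhoC r w x) * cone r (w k).1 x *
        (LamC r δ K w x (w' k).2 - LamC r δ K w x (w k).2)) -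
        ((N + 1 : ℕ) : ℝ) * (FS r δ K h x₀ w' - FS r δ K h x₀ w)| ≤
      3 / (Real.pi * r ^ 3) * Ch * CR0 r δ K * (1 + ‖(w p).2‖ ^ 4 + ‖(w q).2‖ ^ 4) / ((N + 1 : ℕ) : ℝ) := by
  have hN : (0 : ℝ) < ((N + 1 : ℕ) : ℝ) := by positivity
  have hCh : 0 ≤ Ch := (abs_nonneg _).trans (hhb 0)
  -- the integrands
  set M : Fin (N + 1) → T3 → ℝ := fun k x => cone r x x₀ * h (rhoC r w x) * cone r (w k).1 x *
    (LamC r δ K w x (w' k).2 - LamC r δ K w x (w k).2) with hM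
  set A : T3 → ℝ := fun x => cone r x x₀ * h (rhoC r w x) * SC r δ K w x with hA
  set A' : T3 → ℝ := fun x => cone r x x₀ * h (rhoC r w x) * SC r δ K w' x with hA'
  have hIM : ∀ k, Integrable (M k) := fun k => by
    have h1 := integrable_mark_integrand hr hδ K hhb hcont x₀ w k (w' k).2
    have h2 := integrable_mark_integrand hr hδ K hhb hcont x₀ w k (w k).2
    exact (h1.sub h2).congr (Eventually.of_forall fun x => by simp only [hM, Pi.sub_apply]; ring)
  have hIA : Integrable A := integrable_FS_integrand hr hδ K hhb hcont x₀ w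
  have hIA' : Integrable A' := by
    have h1 := integrable_FS_integrand hr hδ K hhb hcont x₀ w' (r := r)
    exact h1.congr (Eventually.of_forall fun x => by simp only [hA', rhoC_eq_of_pos r hpos])
  -- `𝒮(w')` through the density of `w`
  have hFS' : FS r δ K h x₀ w' = ∫ x, A' x := by
    unfold FS
    exact integral_congr_ae (Eventually.of_forall fun x => by simp only [hA', rhoC_eq_of_pos r hpos])
  have hFS : FS r δ K h x₀ w = ∫ x, A x := rfl
  -- everything under one integral
  have hsum : (∑ k, ∫ x, M k x) = ∫ x, ∑ k, M k x := (integral_finsetSum _ fun k _ => hIM k).symm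
  have hIsum : Integrable fun x => ∑ k, M k x := integrable_finsetSum _ fun k _ => hIM k
  have hIAd : Integrable fun x => ((N + 1 : ℕ) : ℝ) * (A' x - A x) := (hIA'.sub hIA).const_mul _
  have hcomb : (∑ k, ∫ x, M k x) - ((N + 1 : ℕ) : ℝ) * (FS r δ K h x₀ w' - FS r δ K h x₀ w) =
      ∫ x, (∑ k, M k x - ((N + 1 : ℕ) : ℝ) * (A' x - A x)) := by
    rw [hsum, hFS', hFS, ← integral_sub hIA' hIA, ← integral_const_mul, ← integral_sub hIsum hIAd]
  rw [show (∑ k, ∫ x, cone r x x₀ * h (rhoC r w x) * cone r (w k).1 x *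
      (LamC r δ K w x (w' k).2 - LamC r δ K w x (w k).2)) = ∑ k, ∫ x, M k x from rfl, hcomb]
  -- pointwise bound by the jump of `S(x)` (helper D)
  have hpt : ∀ x, ‖∑ k, M k x - ((N + 1 : ℕ) : ℝ) * (A' x - A x)‖ ≤
      3 / (Real.pi * r ^ 3) * Ch * CR0 r δ K * (1 + ‖(w p).2‖ ^ 4 + ‖(w q).2‖ ^ 4) / ((N + 1 : ℕ) : ℝ) := by
    intro x
    have hJ := abs_SC_jump_le hr hδ K hpq hpos hvel hen x
    have hid : ∑ k, M k x - ((N + 1 : ℕ) : ℝ) * (A' x - A x) =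
        -(((N + 1 : ℕ) : ℝ) * (cone r x x₀ * h (rhoC r w x)) *
          (SC r δ K w' x - SC r δ K w x - ((N + 1 : ℕ) : ℝ)⁻¹ *
            ∑ k, cone r (w k).1 x * (LamC r δ K w x (w' k).2 - LamC r δ K w x (w k).2))) := by
      have hS : ∑ k, M k x = cone r x x₀ * h (rhoC r w x) *
          ∑ k, cone r (w k).1 x * (LamC r δ K w x (w' k).2 - LamC r δ K w x (w k).2) := by
        simp only [hM, Finset.mul_sum]
        exact Finset.sum_congr rfl fun k _ => by ring
      rw [hS]
      simp only [hA, hA']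
      field_simp
      ring
    rw [hid, norm_neg, Real.norm_eq_abs, abs_mul, abs_mul, abs_mul, abs_of_pos hN, abs_of_nonneg (cone_nonneg hr _ _)]
    have hc := (cone_nonneg_le hr x x₀).2
    have hCR : 0 ≤ CR0 r δ K * (1 + ‖(w p).2‖ ^ 4 + ‖(w q).2‖ ^ 4) / ((N + 1 : ℕ) : ℝ) ^ 2 := by
      have := (phiMax_pos hδ).le; have := (c4_pos δ).le; unfold CR0; positivity
    calc ((N + 1 : ℕ) : ℝ) * (cone r x x₀ * |h (rhoC r w x)|) *
          |SC r δ K w' x - SC r δ K w x - ((N + 1 : ℕ) : ℝ)⁻¹ *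
            ∑ k, cone r (w k).1 x * (LamC r δ K w x (w' k).2 - LamC r δ K w x (w k).2)|
        ≤ ((N + 1 : ℕ) : ℝ) * (3 / (Real.pi * r ^ 3) * Ch) *
          (CR0 r δ K * (1 + ‖(w p).2‖ ^ 4 + ‖(w q).2‖ ^ 4) / ((N + 1 : ℕ) : ℝ) ^ 2) := by
          refine mul_le_mul (mul_le_mul_of_nonneg_left (mul_le_mul hc (hhb _) (abs_nonneg _) (by positivity))
            hN.le) hJ (abs_nonneg _) (by positivity)
      _ = _ := by field_simp
  have h := norm_integral_le_of_norm_le_const (μ := (volume : Measure T3)) (Eventually.of_forall hpt)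
  rwa [probReal_univ, mul_one, Real.norm_eq_abs] at h

/-- REGISTERED SUB-GOAL `stub_windowedEntropyBalanceE` of the line `empirical-h-theorem` (crux
stmt-AtomisticToContinuum-15141): a density weight with `|h a − h b| ≤ L|a − b|` is continuous
(restating `continuous_of_lip`). [folklore] -/
theorem stub_windowedEntropyBalanceE : ∀ (h : ℝ → ℝ) (Lh : ℝ), (∀ a b, |h a - h b| ≤ Lh * |a - b|) → Continuous h :=
  fun _ _ hhL => continuous_of_lip hhL

end Summit.AtomisticToContinuum.HydrodynamicLimit.Theorems.ChaosClosesEulerEntropyBalance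

end
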